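import Mathlib.MeasureTheory.Constructions.Polish.StronglyMeasurable
import Literature.Probability.RandomPlanarGeometry.LoewnerInverseMeasurable
import HarnessLib

/-!
# An adapted version of the SLE trace

Topic `Probability/RandomPlanarGeometry`; theorems only. The SLE_κ trace `sleTrace κ ω` is an
a.e.-defined object: it is the generating curve of the chain driven by `W = √κ B(ω)` on the event
that this chain is generated by a curve, and a junk constant curve otherwise, so that the random
variable `ω ↦ γ(t)` is NOT measurable with respect to the raw σ-algebra `𝓕ᵂ_t` of the Brownian
path up to time `t` (the generation event involves the whole path). This file provides the
standard remedy (Rohde–Schramm (2005), §3, p. 896: "for every `s`, the map `f̂ₛ` is measurable with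
respect to the σ-field generated by `ξ(t)`, `t ∈ [0, s]`"): the **boundary-limit version**

`Y_t(ω) = limₙ f_t(W_t(ω) + i/(n+1)) = limUnder atTop (n ↦ loewnerInvAt t (1/(n+1)) W(ω))`

is `𝓕ᵂ_t`-measurable for every `t` (`measurable_limUnder_loewnerInvAt_sleDriving`), and on the
generation event it IS the trace, simultaneously for all `t`
(`limUnder_loewnerInvAt_sleDriving_eq`, from `IsGeneratedByCurve.tendsto_invFunOn_map_seq`). The
measurability is the filtration-relative form of `measurable_loewnerInvAt_sleDriving`
(`SLETraceMeasurable.lean`; compare `Loewner.measurable_loewnerInv` of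
`LoewnerInverseMeasurable.lean`, the same statement at a FIXED point `w ∈ ℍ` instead of the moving
point `W_t + iy`): `ω ↦ f_t(W_t + iy)` is the everywhere limit of continuous functions of the
finitely many values `W(tk/N)`, `k ≤ N`, all of which are `𝓕ᵂ_t`-measurable; the limit in `n` is
handled by Mathlib's `StronglyMeasurable.limUnder`. The general statements are over an
arbitrary measurable space `Ω` and a random continuous driving path whose values up to time `t`
are measurable (`measurable_loewnerInvAt_of`), so that they specialise to `𝓕ᵂ_t` by taking
`Ω = (ℝ≥0 → ℝ)` with the σ-algebra `brownianFiltration t`.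

This is the input for hitting times of closed sets BY THE TRACE: they are a.s. equal to optional
times of the raw Brownian filtration (`SLETraceHittingMarkov.lean`).

## References

* S. Rohde, O. Schramm, *Basic properties of SLE*, Ann. of Math. 161 (2005), §3 p. 896, Thm. 5.1.
* G. F. Lawler, *Conformally Invariant Processes in the Plane*, AMS (2005), §4.1, §4.4.
-/

noncomputable section

open Set Filter Topology MeasureTheory
open scoped NNReal

namespace Literature.Probability.RandomPlanarGeometry

namespace Loewner

section General

variable {Ω : Type*} {mΩ : MeasurableSpace Ω} {U : Ω → ℝ≥0 → ℝ}

/-- For a random continuous driving path `U` whose values at times `≤ t` are measurable,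
`ω ↦ loewnerInvAt t y (B_N U(ω))` is measurable (a continuous function of the node values
`U(ω)(tk/N)`). [folklore] -/
theorem measurable_loewnerInvAt_bernDriverFun_of (N : ℕ) (t : ℝ≥0) {y : ℝ} (hy : 0 < y)
    (hU : ∀ s ≤ t, Measurable fun ω ↦ U ω s) :
    Measurable fun ω ↦ loewnerInvAt t y (bernDriverFun N t (bernNodes N t (U ω))) := by
  have hv : Measurable fun ω ↦ bernNodes N t (U ω) :=
    measurable_pi_lambda _ fun k ↦ hU _ (bernNode_le N t k)
  exact (continuous_loewnerInvAt_bernDriverFun N t hy).measurable.comp hv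

/-- **`ω ↦ f_t(U_t + iy)` is measurable with respect to any σ-algebra making the values
`U(ω)(s)`, `s ≤ t`, measurable** (continuous paths): the filtration-relative form of
`measurable_loewnerInvAt_sleDriving` — everywhere limit of the measurable Bernstein
approximations (`norm_loewnerInvAt_sub_le`, `bernsteinApproximation_uniform`).
Rohde–Schramm (2005), §3 p. 896. [cite: RohdeSchramm2005, §3 p. 896] -/
theorem measurable_loewnerInvAt_of (hUc : ∀ ω, Continuous (U ω)) (t : ℝ≥0) {y : ℝ} (hy : 0 < y)
    (hU : ∀ s ≤ t, Measurable fun ω ↦ U ω s) :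
    Measurable fun ω ↦ loewnerInvAt t y (U ω) := by
  refine measurable_of_tendsto_metrizable
    (fun N ↦ measurable_loewnerInvAt_bernDriverFun_of N t hy hU) (tendsto_pi_nhds.2 fun ω ↦ ?_)
  have hUc' : Continuous (U ω) := hUc ω
  rw [tendsto_iff_norm_sub_tendsto_zero]
  have hbern := bernsteinApproximation_uniform (rescaleDriver (U ω) hUc' t)
  rw [tendsto_iff_norm_sub_tendsto_zero] at hbern
  refine squeeze_zero (fun N ↦ norm_nonneg _) (fun N ↦ norm_loewnerInvAt_sub_le
    (continuous_bernDriverFun N t _) hUc' t hy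
    fun u hu ↦ abs_bernDriverFun_bernNodes_sub_le hUc' N t hu) ?_
  simpa using hbern.const_mul (2 * Real.exp (8 / y ^ 2 * t))

/-- The boundary limit `ω ↦ limₙ f_t(U_t + i/(n+1))` (Mathlib's `limUnder`, junk where the limit
does not exist) is strongly measurable with respect to any σ-algebra making the values `U(ω)(s)`,
`s ≤ t`, measurable (Mathlib's `StronglyMeasurable.limUnder`). [folklore] -/
theorem stronglyMeasurable_limUnder_loewnerInvAt_of (hUc : ∀ ω, Continuous (U ω)) (t : ℝ≥0)
    (hU : ∀ s ≤ t, Measurable fun ω ↦ U ω s) :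
    StronglyMeasurable fun ω ↦ limUnder atTop
      (fun n : ℕ ↦ loewnerInvAt t ((1 : ℝ) / (n + 1)) (U ω)) :=
  StronglyMeasurable.limUnder (f := fun (n : ℕ) ω ↦ loewnerInvAt t ((1 : ℝ) / (n + 1)) (U ω))
    fun n ↦ (measurable_loewnerInvAt_of hUc t (by positivity) hU).stronglyMeasurable

end General

/-! ### The boundary-limit version of the SLE trace -/

variable (κ : ℝ≥0)

/-- **The boundary-limit version of the trace is adapted**: for every `t`,
`ω ↦ limₙ f_t(W_t(ω) + i/(n+1))` is `𝓕ᵂ_t`-measurable (`W = √κ B`, raw Brownian filtration).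
Rohde–Schramm (2005), §3 p. 896. [cite: RohdeSchramm2005, §3 p. 896] -/
theorem measurable_limUnder_loewnerInvAt_sleDriving (t : ℝ≥0) :
    Measurable[brownianFiltration t] fun ω ↦ limUnder atTop
      (fun n : ℕ ↦ loewnerInvAt t ((1 : ℝ) / (n + 1)) (sleDriving κ ω)) :=
  (stronglyMeasurable_limUnder_loewnerInvAt_of (mΩ := brownianFiltration t)
    (U := fun ω ↦ sleDriving κ ω) (fun ω ↦ continuous_sleDriving κ ω) t
    (fun _ hs ↦ measurable_sleDriving_of_le κ hs)).measurable

variable {κ} in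
/-- **On the generation event the boundary-limit version is the trace**, for all times at once:
`limₙ f_t(W_t + i/(n+1)) = γ(t)` (`IsGeneratedByCurve.tendsto_invFunOn_map_seq`).
Lawler (2005), Prop. 4.27 / Remark 4.32. [cite: Lawler2005, §4.4] -/
theorem limUnder_loewnerInvAt_sleDriving_eq {ω : ℝ≥0 → ℝ}
    (hω : ∃ γ, IsGeneratedByCurve (sleDriving κ ω) γ) (t : ℝ≥0) :
    limUnder atTop (fun n : ℕ ↦ loewnerInvAt t ((1 : ℝ) / (n + 1)) (sleDriving κ ω)) =
      sleTrace κ ω t :=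
  ((isGeneratedByCurve_trace hω).tendsto_invFunOn_map_seq (continuous_sleDriving κ ω) t).limUnder_eq

end Loewner

/-- **An adapted version of the SLE trace.** There is a process `Y : ℝ≥0 → (ℝ≥0 → ℝ) → ℂ`,
adapted to the raw Brownian filtration (`Y t` is `𝓕ᵂ_t`-measurable for every `t`), which
coincides with the trace `γ = sleTrace κ ω` at ALL times on the event that the chain of `√κ B(ω)`
is generated by a curve (an event of probability one under `HasSLETrace κ`). Rohde–Schramm (2005),
§3 p. 896 with Thm. 5.1. [cite: RohdeSchramm2005, §3 p. 896] -/
theorem exists_adapted_traceVersion (κ : ℝ≥0) :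
    ∃ Y : ℝ≥0 → (ℝ≥0 → ℝ) → ℂ, (∀ t, Measurable[brownianFiltration t] (Y t)) ∧
      ∀ ω, (∃ γ, Loewner.IsGeneratedByCurve (sleDriving κ ω) γ) → ∀ t, Y t ω = sleTrace κ ω t :=
  ⟨fun t ω ↦ limUnder atTop (fun n : ℕ ↦ Loewner.loewnerInvAt t ((1 : ℝ) / (n + 1)) (sleDriving κ ω)),
    Loewner.measurable_limUnder_loewnerInvAt_sleDriving κ,
    fun _ hω t ↦ Loewner.limUnder_loewnerInvAt_sleDriving_eq hω t⟩

/-- Under `HasSLETrace κ`, the adapted version agrees with the trace at all times, almost surely.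
[cite: RohdeSchramm2005, §3 p. 896] -/
theorem exists_adapted_ae_eq_sleTrace {κ : ℝ≥0} (h0 : HasSLETrace κ) :
    ∃ Y : ℝ≥0 → (ℝ≥0 → ℝ) → ℂ, (∀ t, Measurable[brownianFiltration t] (Y t)) ∧
      ∀ᵐ ω ∂Process.preWienerMeasure, ∀ t, Y t ω = sleTrace κ ω t := by
  obtain ⟨Y, hY, hYeq⟩ := exists_adapted_traceVersion κ
  exact ⟨Y, hY, by filter_upwards [h0] with ω hω using hYeq ω hω⟩

end Literature.Probability.RandomPlanarGeometry
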